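/-
Copyright (c) 2026 the pub-hodgecm-mathlib formalisation cell (harness21).  Prover seat hodgecm-mathlib-K2Liu-p27 (g3) = F4 (G-gen) desk, Track B «K2-LIT» ∕ hLiu418,
#42F′ FACE-G organ F4, (L3-tie): THE L3-DX LETTER ON THE SIGN-FRAME ARCH CLASS AT THE SINGLE-PLACE DIRECTION FAMILY OF RECORD — LETTER-FREE (LEAD F0P6-plan (g15) BATCH #224,
RULING M-160e «pointwise ladder»).  THEOREMS ONLY.
-/
import Summits.HodgeConjecture.HodgeConjecture.Theorems.K2LiuFaceGGeneratorsInDomainOfRecordStd   -- ★ p864013 (this seat): `hGgen_of_record_of_hK₀` (L3-DX modulo `hDX`, `hK₀`)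
import Summits.HodgeConjecture.HodgeConjecture.Theorems.K2LiuIwasawaDatumOfRecordSignFrames       -- ★ p863732 (K2E3-p31): `exists_isStd_signFrameAdapted`, `hK₀_of_archClass`
import HarnessLib

/-!
# Crux `HLiu418`, #42F′ FACE-G, organ F4 (G-gen) — (L3-tie): the L3-DX letter `hGgen` AT A STANDARD DATUM OF THE SIGN-FRAME ARCH CLASS, at the hol cut of record and
# the SINGLE-PLACE direction family of record — NO letter by value

Cell `hodgecm-mathlib`, crux item hLiu418 = `stmt-HodgeConjecture-24832` (helper lane `--kind proof --supports stmt-HodgeConjecture-24832 --as helper`, count-neutral;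
closes no socket); squad K2 ∕ K2Liu; LEAD F0P6-plan (g15) (RULING M-160e «the #42F′ closing shape is the POINTWISE LADDER»; BATCH #224 (i)); F4 desk K2Liu-p27 (g3);
consumers K2Liu-p23 (g3) (F1-pw) `K2LiuFaceGAssemblerAtDatum.faceG_at_of_organs_directed … (hGgen𝒦)` and R90-C10-p03's (T-F′) fold `fun 𝒦 h𝒦 hcl => …`; box K2E5-r02 (g7).
THEOREMS ONLY (no `def`, no `instance`, no notation, no named-fact hypothesis, no `sorry`).

WHAT.  ★ p864013 `K2LiuFaceGGeneratorsInDomainOfRecordStd.hGgen_of_record_of_hK₀ (DX) … (𝒦) (h𝒦) (hDX) (hK₀)` is the L3-DX letter (binder 3 of ★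
`faceG_of_organs_directed DX holCutOfRecord`, AT the datum `𝒦`) modulo two letters: `hDX` («the direction family sees the chart-image directions», trivially true at the
single-place family of record `X ↦ ∃ w₀, ∀ w ≠ w₀, X_w = 0`, F1 desk 2026-09-05T00:23:21Z; same spelling as ★ LH7-p08 `K2LiuFaceGThetaOrbitInDomainOfRecord.hGTheta_single`)
and `hK₀` («the arch part of `𝒦.K` is generated by the one-place sign-frame compacts»), which ★ p863732 K2E3-p31 `hK₀_of_archClass hsf₁ 𝒦 h𝒦 hcl` pays for every standard
`𝒦` in the ARCH CLASS of the sign-frame-adapted reference datum `𝒦₁` (★ `exists_isStd_signFrameAdapted`; M-160c (i)).  THIS FILE is the two substitutions: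
* **`hGgen_on_archClass ‹prefix› {𝒦₁} (hsf₁) (𝒦) (h𝒦) (hcl) : ‹★ hGgen's body :193–231 at 𝒦, HL := holCutOfRecord, DX := single-place (spelled out)›`** — the letter-free
  L3 rung of the pointwise ladder: `hGgen𝒦 := hGgen_on_archClass … hsf₁ 𝒦 h𝒦 hcl` inside the (T-F′) fold.  Proof: one application of ★ p864013 at the single-place family
  with `hDX := fun σ _ _ _ _ _ _ hw => ⟨cmPlaceOver L σ, hw⟩` and `hK₀ := hK₀_of_archClass … hsf₁ 𝒦 h𝒦 hcl`.
References: [Howe1989] §3; [KudlaRallis1994] §1 Thm. 1.1, §3; [Folland1989] §1.7 (1.81), §4.2 Prop. (4.39); [Liu2021] App. B proof of Prop. B.8 pp. 103–106 — citations for the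
docstring; the file is one application.
HONEST LABEL.  Count-neutral helper; `HC_CM` is proved only modulo the 7 printed citations (2 remaining named inputs: hLiu418 = `stmt-HodgeConjecture-24832`,
h413 = `stmt-HodgeConjecture-24833`) until rung 0 closes.
-/

set_option autoImplicit false
set_option linter.dupNamespace false -- the mandated namespace repeats `HodgeConjecture.HodgeConjecture`

noncomputable section

open scoped Classical Matrix MatrixGroups TensorProduct Kronecker SchwartzMap Real
open MvPolynomial Complex
open NumberField NumberField.InfinitePlace NumberField.mixedEmbedding IsDedekindDomain
open Literature.Analysis.SegalBargmann Literature.RepresentationTheory.HeisenbergGroup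
open Literature.NumberTheory.Automorphic Literature.NumberTheory.Automorphic.UnitaryGroup Literature.NumberTheory.GaloisRepresentations
open Literature.NumberTheory.Weil1964 Literature.NumberTheory.Weil1964.MpS Literature.NumberTheory.Weil1964.UnitaryWeil
open Literature.RepresentationTheory.HarrisKudlaSweet1996
open Literature.RepresentationTheory.KonnoKonno2007 hiding LetterKind letterOf letterGen letterOf_boost letterOf_torus letterOf_torus_eq
  letterGen_boost letterGen_torus letterGen_mem_lie exp_smul_letterGen
open Literature.RepresentationTheory.KonnoKonno2007.RealDualPair
open Literature.RepresentationTheory.KonnoKonno2007.RealDualPair.UForm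
open Literature.NumberTheory.GelbartRogawski1991 Literature.NumberTheory.GelbartRogawski1991.GRConstruction
open Literature.NumberTheory.GelbartRogawski1991.UnitaryDualPair
open Literature.NumberTheory.GelbartRogawski1991.UnitaryDualPair.LocalSplitting
open Literature.NumberTheory.K2Lit.SiegelDoubled
open Literature.NumberTheory.Automorphic.IdeleClassGroup
open Literature.NumberTheory.Automorphic.Liu2021
open Literature.NumberTheory.Automorphic.Liu2021.Def411WeilCarriers
open Literature.NumberTheory.Automorphic.Liu2021.Def411WeilCarriersDoubling
open Literature.RepresentationTheory.Liu2021
open Summit.HodgeConjecture.HodgeConjecture.Cruxes.HLiu418.K2LiuArchSectionPlaceBlock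
open Summit.HodgeConjecture.HodgeConjecture.Cruxes.HLiu418 (K2LiuArchOneParameterOrbitDefs.archEmb K2LiuArchOneParameterOrbitDefs.archExp)
open Summit.HodgeConjecture.HodgeConjecture.Cruxes.HLiu418.K2LiuFaceGLetterDefs (IsArchStable genFamily HasArchDeriv)
open Summit.HodgeConjecture.HodgeConjecture.Cruxes.HLiu418.K2LiuArchSWDataTuplesDefs
open Summit.HodgeConjecture.HodgeConjecture.Cruxes.HLiu418.K2LiuArchSWSpanningDefs (IsArchDatum)
open Summit.HodgeConjecture.HodgeConjecture.Cruxes.HLiu418.K2LiuArchDoubledSignFrameTwo (exists_signFrame_two eq_two_of_frame)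

namespace Summit.HodgeConjecture.HodgeConjecture.Cruxes.HLiu418.K2LiuFaceGGeneratorsOnSignFrameClass

/-- **(L3-tie) THE L3-DX LETTER `hGgen` ON THE SIGN-FRAME ARCH CLASS, LETTER-FREE** — ★ `faceG_of_organs_directed`'s binder-3 body AT a standard datum `𝒦` whose
archimedean elements are those of the sign-frame-adapted reference `𝒦₁` (`hsf₁`, `hcl`), at `HL := holCutOfRecord` and the single-place direction family of record
(`X ↦ ∃ w₀, ∀ w ≠ w₀, X.map (evalC L w) = 0`, spelled out in the (deriv) clause): the induction principle on admissible data holds there with NO letter by value.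
One application of ★ p864013 `hGgen_of_record_of_hK₀` ∘ ★ p863732 `hK₀_of_archClass`. [cite: Howe1989, §3] [cite: KudlaRallis1994, §1 Thm. 1.1, §3]
[cite: Folland1989, §1.7 (1.81), §4.2 Prop. (4.39)] [cite: Liu2021, App. B proof of Prop. B.8 pp. 103–106] -/
theorem hGgen_on_archClass
    (L : Type) [Field L] [NumberField L] [IsCMField L] {n : ℕ} (e : Fin 2 × Fin 1 ≃ Fin n)
      (dV : Fin 2 → L) (hdV : ∀ i, IsCMField.complexConj L (dV i) = dV i) (hdV0 : ∀ i, dV i ≠ 0)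
      (dW : Fin 1 → L) (hdW : ∀ i, IsCMField.complexConj L (dW i) = dW i) (hdW0 : ∀ i, dW i ≠ 0)
      (lam : Literature.NumberTheory.Automorphic.IdeleClassGroup L →ₜ* Circle) (hlam : IsConjugateSymplectic L lam)
      (_hwt : HasWeight L lam 1)
      {M' n' : ℕ} (eW : Fin 1 × Fin 3 ≃ Fin M') (e' : Fin 2 × Fin M' ≃ Fin n')
        (dV' : Fin 3 → L) (hdV' : ∀ k, IsCMField.complexConj L (dV' k) = dV' k) (hdV'0 : ∀ k, dV' k ≠ 0)
        (χb : HeckeCharacter L) (hχbu : χb.IsUnitary) (hχbs : Literature.RepresentationTheory.HarrisKudlaSweet1996.IsSplittingChar L 1 χb)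
        (α : UnitaryGroup.adelicOne (Fp L) L (IsCMField.complexConj L) →* ℂˣ) (hα : Continuous α)
        (hαrat : ∀ u : UnitaryGroup.adelicOne (Fp L) L (IsCMField.complexConj L),
          (u : Literature.NumberTheory.GaloisRepresentations.ideleGroup L) ∈ Literature.NumberTheory.GaloisRepresentations.principalIdeles L → α u = 1)
        (_hχD : χb ^ 3 * DoubledWeilDetTwist.ratioHecke L α hα hαrat = toHeckeCharacter L lam⁻¹)
    -- the SIGN-FRAME-ADAPTED reference datum `𝒦₁` (★ p863732 K2E3-p31 `exists_isStd_signFrameAdapted`: its arch part IS the frame-compact submonoid) and the ARCH CLASS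
    -- hypothesis `hcl` (★ `span_of_archReference` :322–324 ∕ ★ `hK₀_of_archClass` bytes): `𝒦` and `𝒦₁` have the same archimedean elements
    {𝒦₁ : IwasawaDatum L e dV hdV dW hdW}
    (hsf₁ : ∀ a : UnitaryGroup.arch (Fp L) L (IsCMField.complexConj L) (n + n) (hermD L e dV hdV dW hdW),
        (UnitaryGroup.archToAdelic (Fp L) L (IsCMField.complexConj L) (n + n) (hermD L e dV hdV dW hdW) a : HA L e dV hdV dW hdW) ∈ 𝒦₁.K ↔
          a ∈ Submonoid.closure {k : UnitaryGroup.arch (Fp L) L (IsCMField.complexConj L) (n + n) (hermD L e dV hdV dW hdW) |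
          ∃ (σ : {v : InfinitePlace (Fp L) // v.IsReal}) (k₁ : Matrix.unitaryGroup (PosIdx (signVec (cmPlaceOver L) (fun k => Sum.elim (cmGramEntry L e dV hdV dW hdW) (-cmGramEntry L e dV hdV dW hdW) ((LocalSplitting.e₂ n).symm k)) (imagUnit L) σ)) ℂ × Matrix.unitaryGroup (NegIdx (signVec (cmPlaceOver L) (fun k => Sum.elim (cmGramEntry L e dV hdV dW hdW) (-cmGramEntry L e dV hdV dW hdW) ((LocalSplitting.e₂ n).symm k)) (imagUnit L) σ)) ℂ),
            k = placeSec L (IsCMField.complexConj L) (n + n) (IsCMField.complexConj_ne_one L) (cmPlaceOver L) (cmPlaceOver_smul L) (fun k => Sum.elim (cmGramEntry L e dV hdV dW hdW) (-cmGramEntry L e dV hdV dW hdW) ((LocalSplitting.e₂ n).symm k))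
            (gramD_gram_realDiagonal_entry_ne_zero L e dV hdV dW hdW hdV0 hdW0) (complexConj_imagUnit L) (imagUnit_ne_zero L) σ
            (cmPlaceOver_comap L) (gramD_eq_diagonal_cm L e dV hdV dW hdW) (J := hermD L e dV hdV dW hdW) rfl
            (complexConj_smul_infinitePlace L) (UForm.kV _ _ k₁)})
    (𝒦 : IwasawaDatum L e dV hdV dW hdW) (h𝒦 : 𝒦.IsStd)
    (hcl : ∀ a : UnitaryGroup.arch (Fp L) L (IsCMField.complexConj L) (n + n) (hermD L e dV hdV dW hdW),
        (UnitaryGroup.archToAdelic (Fp L) L (IsCMField.complexConj L) (n + n) (hermD L e dV hdV dW hdW) a : HA L e dV hdV dW hdW) ∈ 𝒦.K ↔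
          (UnitaryGroup.archToAdelic (Fp L) L (IsCMField.complexConj L) (n + n) (hermD L e dV hdV dW hdW) a : HA L e dV hdV dW hdW) ∈ 𝒦₁.K) :
      -- (G-gen) on the ISOTROPIC branch (line of record `a′`, adelic Witt frame `T`), THE INDUCTION PRINCIPLE ON ADMISSIBLE DATA: a property of admissible data
      -- holding on the hol-cut (`HL`) domains and stable under equality of the underlying function, `0`, `+`, `•` and arch derivative steps of the `s₀`-sections
      -- holds everywhere (content: cyclicity of `R_σ(V′_σ)` on the Gaussian at each indefinite real place `σ`)
      ∀ (a' : (↥(maximalRealSubfield L))ˣ) (T : GL (Fin 3) (AdeleRing (𝓞 L) L)),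
        formCongr (conjAdele (Fp L) L (IsCMField.complexConj L)) T (adelicForm L 3 (Matrix.diagonal dV')) =
          adelicForm L (1 + 2) (finSum 1 2 (JW (Fp L) L a') !![0, 1; 1, 0]) →
        -((a' : Fp L) : L) ∈ (Set.range fun A : Matrix (Fin 3) (Fin 3) L =>
          (A.map (IsCMField.complexConj L : L →+* L)).det * (∏ k, dV' k) * A.det) →
      ∀ (Good : (V : Submodule ℂ 𝓢(((Fin (n' + n')) → mixedSpace (Fp L)), ℂ)) → ↥(Submodule.span ℂ {x : piSchwartzBruhat (Fp L) (Fin (n' + n')) |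
              ∃ a ∈ V, ∃ f : FinSB (Fp L) (Fin (n' + n')), x = piSchwartzBruhatEquiv (Fp L) (Fin (n' + n')) (a ⊗ₜ[ℂ] f)}) → Prop),
        -- (base) the hol-cut domains
        (∀ (V₀ : Submodule ℂ 𝓢(((Fin (n' + n')) → mixedSpace (Fp L)), ℂ)), FiniteDimensional ℂ V₀ → IsArchStable L e dV hdV hdV0 dW hdW hdW0 eW e' dV' hdV' hdV'0 χb hχbu hχbs 𝒦 V₀ →
          K2LiuArchGaussianOfRecord.holCutOfRecord L e dV hdV hdV0 dW hdW hdW0 lam hlam eW e' dV' hdV' hdV'0 χb hχbu hχbs α hα hαrat 𝒦 V₀ → ∀ x₀ : ↥(Submodule.span ℂ {x : piSchwartzBruhat (Fp L) (Fin (n' + n')) |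
              ∃ a ∈ V₀, ∃ f : FinSB (Fp L) (Fin (n' + n')), x = piSchwartzBruhatEquiv (Fp L) (Fin (n' + n')) (a ⊗ₜ[ℂ] f)}), Good V₀ x₀) →
        -- (congr) `Good` reads the datum only through its twisted Siegel–Weil generator family `g_x` (so data with EQUAL SECTIONS are interchangeable;
        -- in particular a datum whose section vanishes is as good as `0`)
        (∀ (V V' : Submodule ℂ 𝓢(((Fin (n' + n')) → mixedSpace (Fp L)), ℂ)) (x : ↥(Submodule.span ℂ {x : piSchwartzBruhat (Fp L) (Fin (n' + n')) |
              ∃ a ∈ V, ∃ f : FinSB (Fp L) (Fin (n' + n')), x = piSchwartzBruhatEquiv (Fp L) (Fin (n' + n')) (a ⊗ₜ[ℂ] f)})) (x' : ↥(Submodule.span ℂ {x : piSchwartzBruhat (Fp L) (Fin (n' + n')) |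
              ∃ a ∈ V', ∃ f : FinSB (Fp L) (Fin (n' + n')), x = piSchwartzBruhatEquiv (Fp L) (Fin (n' + n')) (a ⊗ₜ[ℂ] f)})),
          genFamily L e dV hdV hdV0 dW hdW hdW0 eW e' dV' hdV' hdV'0 χb hχbu hχbs α 𝒦 (x : piSchwartzBruhat (Fp L) (Fin (n' + n'))) =
            genFamily L e dV hdV hdV0 dW hdW hdW0 eW e' dV' hdV' hdV'0 χb hχbu hχbs α 𝒦 (x' : piSchwartzBruhat (Fp L) (Fin (n' + n'))) → Good V x → Good V' x') →
        -- (zero) (add) (smul)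
        (∀ (V : Submodule ℂ 𝓢(((Fin (n' + n')) → mixedSpace (Fp L)), ℂ)), FiniteDimensional ℂ V → IsArchStable L e dV hdV hdV0 dW hdW hdW0 eW e' dV' hdV' hdV'0 χb hχbu hχbs 𝒦 V → Good V 0) →
        (∀ (V : Submodule ℂ 𝓢(((Fin (n' + n')) → mixedSpace (Fp L)), ℂ)), FiniteDimensional ℂ V → IsArchStable L e dV hdV hdV0 dW hdW hdW0 eW e' dV' hdV' hdV'0 χb hχbu hχbs 𝒦 V →
          ∀ x y : ↥(Submodule.span ℂ {x : piSchwartzBruhat (Fp L) (Fin (n' + n')) |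
              ∃ a ∈ V, ∃ f : FinSB (Fp L) (Fin (n' + n')), x = piSchwartzBruhatEquiv (Fp L) (Fin (n' + n')) (a ⊗ₜ[ℂ] f)}), Good V x → Good V y → Good V (x + y)) →
        (∀ (V : Submodule ℂ 𝓢(((Fin (n' + n')) → mixedSpace (Fp L)), ℂ)), FiniteDimensional ℂ V → IsArchStable L e dV hdV hdV0 dW hdW hdW0 eW e' dV' hdV' hdV'0 χb hχbu hχbs 𝒦 V →
          ∀ (c : ℂ) (x : ↥(Submodule.span ℂ {x : piSchwartzBruhat (Fp L) (Fin (n' + n')) |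
              ∃ a ∈ V, ∃ f : FinSB (Fp L) (Fin (n' + n')), x = piSchwartzBruhatEquiv (Fp L) (Fin (n' + n')) (a ⊗ₜ[ℂ] f)})), Good V x → Good V (c • x)) →
        -- (deriv) stability under arch Lie derivative steps of the `s₀`-sections of the generator families
        (∀ (V : Submodule ℂ 𝓢(((Fin (n' + n')) → mixedSpace (Fp L)), ℂ)), FiniteDimensional ℂ V → IsArchStable L e dV hdV hdV0 dW hdW hdW0 eW e' dV' hdV' hdV'0 χb hχbu hχbs 𝒦 V →
          ∀ x : ↥(Submodule.span ℂ {x : piSchwartzBruhat (Fp L) (Fin (n' + n')) |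
              ∃ a ∈ V, ∃ f : FinSB (Fp L) (Fin (n' + n')), x = piSchwartzBruhatEquiv (Fp L) (Fin (n' + n')) (a ⊗ₜ[ℂ] f)}), Good V x →
          ∀ (X : Matrix (Fin (n + n)) (Fin (n + n)) (mixedSpace L)) (hX : X ∈ archSkew (Fp L) L (IsCMField.complexConj L) (n + n) (hermD L e dV hdV dW hdW)) (_hXD : ∃ w₀ : {w : InfinitePlace L // w.IsComplex}, ∀ w : {w : InfinitePlace L // w.IsComplex}, w ≠ w₀ → X.map (evalC L w) = 0)
            (V' : Submodule ℂ 𝓢(((Fin (n' + n')) → mixedSpace (Fp L)), ℂ)), FiniteDimensional ℂ V' → IsArchStable L e dV hdV hdV0 dW hdW hdW0 eW e' dV' hdV' hdV'0 χb hχbu hχbs 𝒦 V' →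
          ∀ x' : ↥(Submodule.span ℂ {x : piSchwartzBruhat (Fp L) (Fin (n' + n')) |
              ∃ a ∈ V', ∃ f : FinSB (Fp L) (Fin (n' + n')), x = piSchwartzBruhatEquiv (Fp L) (Fin (n' + n')) (a ⊗ₜ[ℂ] f)}),
          HasArchDeriv L e dV hdV dW hdW hX (fun h => genFamily L e dV hdV hdV0 dW hdW hdW0 eW e' dV' hdV' hdV'0 χb hχbu hχbs α 𝒦 (x : piSchwartzBruhat (Fp L) (Fin (n' + n'))) ((((3 : ℕ) : ℂ) - (n : ℂ)) / 2) h)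
            (fun h => genFamily L e dV hdV hdV0 dW hdW hdW0 eW e' dV' hdV' hdV'0 χb hχbu hχbs α 𝒦 (x' : piSchwartzBruhat (Fp L) (Fin (n' + n'))) ((((3 : ℕ) : ℂ) - (n : ℂ)) / 2) h) → Good V' x') →
        ∀ (V : Submodule ℂ 𝓢(((Fin (n' + n')) → mixedSpace (Fp L)), ℂ)), FiniteDimensional ℂ V → IsArchStable L e dV hdV hdV0 dW hdW hdW0 eW e' dV' hdV' hdV'0 χb hχbu hχbs 𝒦 V →
          ∀ x : ↥(Submodule.span ℂ {x : piSchwartzBruhat (Fp L) (Fin (n' + n')) |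
              ∃ a ∈ V, ∃ f : FinSB (Fp L) (Fin (n' + n')), x = piSchwartzBruhatEquiv (Fp L) (Fin (n' + n')) (a ⊗ₜ[ℂ] f)}), Good V x :=
  K2LiuFaceGGeneratorsInDomainOfRecordStd.hGgen_of_record_of_hK₀
    (fun L _ _ _ _ _ _ _ _ _ X =>
      ∃ w₀ : {w : InfinitePlace L // w.IsComplex}, ∀ w : {w : InfinitePlace L // w.IsComplex}, w ≠ w₀ → X.map (evalC L w) = 0)
    L e dV hdV hdV0 dW hdW hdW0 lam hlam _hwt eW e' dV' hdV' hdV'0 χb hχbu hχbs α hα hαrat _hχD 𝒦 h𝒦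
    (fun σ _ _ _ _ _ _ hw => ⟨cmPlaceOver L σ, hw⟩)
    (K2LiuIwasawaDatumOfRecordSignFrames.hK₀_of_archClass L e dV hdV hdV0 dW hdW hdW0 hsf₁ 𝒦 h𝒦 hcl)

end Summit.HodgeConjecture.HodgeConjecture.Cruxes.HLiu418.K2LiuFaceGGeneratorsOnSignFrameClass

end
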